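import Mathlib
import HarnessLib
import Summits.HubbardSuperconductivity.HubbardSuperconductivity.Theorems.WeakCouplingBCSWcbcsKohnLuttingerB1gMuWindow
import Summits.HubbardSuperconductivity.HubbardSuperconductivity.Theorems.WeakCouplingBCSKlCertFillingUpperD020
import Summits.HubbardSuperconductivity.HubbardSuperconductivity.Theorems.WeakCouplingBCSKlCertFillingLowerD020
import Summits.HubbardSuperconductivity.HubbardSuperconductivity.Theorems.WeakCouplingBCSKlSelectionD020Cell

/-!
# Route `WeakCouplingBCS` — channel-margin lane of `WcbcsKohnLuttingerB1g` (stmt-HubbardSuperconductivity-0158):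
# the `δ = 0.20` POINT: `μ(0.20) ∈ [-0.42749, -0.4242] ⊂` the `klCertB1gD020Cell` box, and `B1g` selection AT `δ = 0.20` for `0 < U ≤ klU0D020CellU`

`Theorems/WeakCouplingBCSKlSelectionD020Cell.lean` states the explicit-`U₀` selection theorems for every `μ` of the record box `[-0.42918, -0.4242]`
of `klCertB1gD020Cell`.  To read them AT THE DOPING `δ = 0.20` one needs the free-band chemical potential `μ(0.20) = chemicalPotentialOfDensity ε₀ (4/5)`
inside that box.  The tree had the upper filling certificate `n(-0.42749) ≤ 4/5` (`klfillU020_filling_le`) but no lower one near the box's upper end;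
`Theorems/WeakCouplingBCSKlCertFillingLowerD020.lean` (this generation) supplies `n(-0.4242) ≥ 4/5` (inscribed polygon, margin `8.7·10⁻⁴`).  Hence
(`chemicalPotentialOfDensity_window`): **`μ(δ) ∈ [-0.42749, -0.4242]` for `δ = 0.20`** (`muOfDoping_d020_mem_Icc`, `muOfDoping_d020_mem`; true value `-0.42669`), and the
`δ = 0.20` point corollaries of the cell theorems: third order, resummed chains, channel bottoms, for `0 < U ≤ klU0D020CellU = 6537/2²³ ≈ 7.79·10⁻⁴`,
modulo the same named hypotheses (`klCertB1gD020Cell.EnclosuresB1g` and the row's window hypotheses).  Existence-grade threshold; `C4` ASSUMED in the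
all-orders reading; nothing here asserts superconductivity.  Cell file: U0-TABLE.md v4 §A (gate-hubbard-kl, margin-1 g9).

References: D. J. Scalapino, E. Loh, J. E. Hirsch, Phys. Rev. B 34 (1986) 8190, (3)–(4); S. Raghu, S. A. Kivelson, D. J. Scalapino,
Phys. Rev. B 81 (2010) 224505, App. A.
-/

noncomputable section

-- the tree's namespace `Summit.<Summit>.<Problem>.Theorems` repeats the summit name by design (D-0017)
set_option linter.dupNamespace false

namespace Summit.HubbardSuperconductivity.HubbardSuperconductivity.Theorems

open MeasureTheory Literature.MathematicalPhysics.QuantumLattice CwKLChiralWindow KlThirdOrder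
open Summit.HubbardSuperconductivity.HubbardSuperconductivity.Theses.WeakCouplingBCS

/-- **`μ(0.20) ∈ [-0.42749, -0.4242]`**: the free-band chemical potential of the hole doping `δ = 0.20` (true value `-0.42669`), from the
certified fillings `n(-0.4242) ≥ 4/5` (`klfillL020_filling_ge`, this generation) and `n(-0.42749) ≤ 4/5` (`klfillU020_filling_le`) through
`chemicalPotentialOfDensity_window`. [folklore] -/
theorem muOfDoping_d020_mem_Icc :
    chemicalPotentialOfDensity (squareDispersion 1 0) (1 - 0.20) ∈ Set.Icc (-0.42749 : ℝ) (-0.4242) := by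
  obtain ⟨-, -, -, H⟩ := chemicalPotentialOfDensity_window (μ₁ := (-0.4242 : ℝ)) (μ₂ := (-0.42749 : ℝ))
    (by norm_num) (by norm_num) (by norm_num)
  have hlo := klfillL020_filling_ge
  have hhi := klfillU020_filling_le
  rw [show (-(2121 / 5000) : ℝ) = -0.4242 by norm_num] at hlo
  rw [show (-(42749 / 100000) : ℝ) = -0.42749 by norm_num] at hhi
  refine H 0.20 ⟨?_, ?_⟩
  · norm_num at hlo ⊢; linarith
  · norm_num at hhi ⊢; linarith

/-- **The free-band chemical potential at `δ = 0.20` lies in the `klCertB1gD020Cell` box**: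
`-0.42918 ≤ -0.42749 ≤ μ(0.20) ≤ -0.4242`. [folklore] -/
theorem muOfDoping_d020_mem :
    ((((-21459 : ℚ) / 50000) : ℚ) : ℝ) ≤ chemicalPotentialOfDensity (squareDispersion 1 0) (1 - 0.20) ∧
      chemicalPotentialOfDensity (squareDispersion 1 0) (1 - 0.20) ≤ ((((-2121 : ℚ) / 5000) : ℚ) : ℝ) := by
  obtain ⟨h₁, h₂⟩ := muOfDoping_d020_mem_Icc
  exact ⟨by push_cast; linarith, by push_cast; linarith⟩

/-- **At `δ = 0.20`: `B1g` selection through the complete THIRD ORDER of the pp-irreducible Cooper vertex for `0 < U ≤ klU0D020CellU ≈ 7.79·10⁻⁴`**: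
some `B1g` channel state on `F_{μ(0.20)}` lies strictly below every normalised `A1g/A2g/B2g/E` state of `thirdOrderForm ε₀ μ(0.20) U` — modulo
`klCertB1gD020Cell.EnclosuresB1g` and `KlThirdOrderWindowEnclosures klU0D020CellRows [klCertB1gD020Cell]`. [cite: RaghuKivelsonScalapino2010, App. A] -/
theorem klThirdOrder_selection_d020 (hA : klCertB1gD020Cell.EnclosuresB1g)
    (h3 : KlThirdOrderWindowEnclosures klU0D020CellRows [klCertB1gD020Cell]) :
    ∃ ψ : Momentum → ℝ,
      IsChannelState (squareDispersion 1 0) (chemicalPotentialOfDensity (squareDispersion 1 0) (1 - 0.20)) D4Irrep.B1g ψ ∧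
        ∀ U : ℝ, 0 < U → U ≤ ((klU0D020CellU : ℚ) : ℝ) → ∀ χ : D4Irrep, χ ≠ D4Irrep.B1g →
          ∀ φ : Momentum → ℝ,
            IsChannelState (squareDispersion 1 0) (chemicalPotentialOfDensity (squareDispersion 1 0) (1 - 0.20)) χ φ →
              thirdOrderForm (squareDispersion 1 0) (chemicalPotentialOfDensity (squareDispersion 1 0) (1 - 0.20)) U ψ <
                thirdOrderForm (squareDispersion 1 0) (chemicalPotentialOfDensity (squareDispersion 1 0) (1 - 0.20)) U φ :=
  klThirdOrder_selection_d020cell hA h3 _ muOfDoping_d020_mem.1 muOfDoping_d020_mem.2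

/-- **At `δ = 0.20`, chains RESUMMED**: `B1g` selection in `resummedForm ε₀ μ(0.20) U` for `0 < U ≤ klU0D020CellU`, modulo
`klCertB1gD020Cell.EnclosuresB1g` and `KlResummedWindowEnclosures klU0D020CellRows [klCertB1gD020Cell]`. [cite: ScalapinoLohHirsch1986, (3)-(4)] -/
theorem klResummed_selection_d020 (hA : klCertB1gD020Cell.EnclosuresB1g)
    (h3 : KlResummedWindowEnclosures klU0D020CellRows [klCertB1gD020Cell]) :
    ∃ ψ : Momentum → ℝ,
      IsChannelState (squareDispersion 1 0) (chemicalPotentialOfDensity (squareDispersion 1 0) (1 - 0.20)) D4Irrep.B1g ψ ∧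
        ∀ U : ℝ, 0 < U → U ≤ ((klU0D020CellU : ℚ) : ℝ) → ∀ χ : D4Irrep, χ ≠ D4Irrep.B1g →
          ∀ φ : Momentum → ℝ,
            IsChannelState (squareDispersion 1 0) (chemicalPotentialOfDensity (squareDispersion 1 0) (1 - 0.20)) χ φ →
              resummedForm (squareDispersion 1 0) (chemicalPotentialOfDensity (squareDispersion 1 0) (1 - 0.20)) U ψ <
                resummedForm (squareDispersion 1 0) (chemicalPotentialOfDensity (squareDispersion 1 0) (1 - 0.20)) U φ :=
  klResummed_selection_d020cell hA h3 _ muOfDoping_d020_mem.1 muOfDoping_d020_mem.2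

/-- **At `δ = 0.20`, `B1g` has the strictly lowest third-order CHANNEL BOTTOM**: for every `0 < U ≤ klU0D020CellU` and every `χ ≠ B1g`,
`channelInf3 ε₀ μ(0.20) U B1g < channelInf3 ε₀ μ(0.20) U χ`, modulo `klCertB1gD020Cell.EnclosuresB1g`, `KlThirdOrderWindowEnclosures klU0D020CellRows
[klCertB1gD020Cell]` and the row's `A2g` datum read on the `B1g` states. [cite: RaghuKivelsonScalapino2010, App. A] -/
theorem klThirdOrder_channelInf3_lt_d020 (hA : klCertB1gD020Cell.EnclosuresB1g)
    (h3 : KlThirdOrderWindowEnclosures klU0D020CellRows [klCertB1gD020Cell])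
    (hB1g : ∀ w ∈ klU0D020CellRows, ∀ μ : ℝ, ((w.mulo : ℚ) : ℝ) ≤ μ → μ ≤ ((w.muhi : ℚ) : ℝ) →
      (w.row.chanOf D4Irrep.A2g).ThirdOrderLowerBound μ D4Irrep.B1g) :
    ∀ U : ℝ, 0 < U → U ≤ ((klU0D020CellU : ℚ) : ℝ) → ∀ χ : D4Irrep, χ ≠ D4Irrep.B1g →
      channelInf3 (squareDispersion 1 0) (chemicalPotentialOfDensity (squareDispersion 1 0) (1 - 0.20)) U D4Irrep.B1g <
        channelInf3 (squareDispersion 1 0) (chemicalPotentialOfDensity (squareDispersion 1 0) (1 - 0.20)) U χ :=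
  klThirdOrder_channelInf3_lt_d020cell hA h3 hB1g _ muOfDoping_d020_mem.1 muOfDoping_d020_mem.2

/-- The threshold of the `δ = 0.20` point theorems, as a real number: `klU0D020CellU = 6537/2²³`, i.e. every `0 < U ≤ 7.79·10⁻⁴` qualifies
(`7.79e-4 < 6537/8388608`). [folklore] -/
theorem klU0D020CellU_real : ((klU0D020CellU : ℚ) : ℝ) = 6537 / 8388608 ∧ (7.79e-4 : ℝ) < 6537 / 8388608 := by
  refine ⟨?_, by norm_num⟩
  show ((((6537 : ℚ) / 8388608) : ℚ) : ℝ) = 6537 / 8388608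
  push_cast; ring

end Summit.HubbardSuperconductivity.HubbardSuperconductivity.Theorems

end
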